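import Summits.SmoothPoincare4.SmoothPoincare4.Theorems.SullivanDualTargetOfSympcap
import Literature.Geometry.Symplectic.GromovR4StdModel
import Literature.Geometry.GeometricMeasureTheory.RadialProfiles
import Mathlib.Analysis.SpecialFunctions.SmoothTransition
import Mathlib.Analysis.SpecialFunctions.Log.Deriv

/-!
# SmoothPoincare4 / SullivanDual — crux `Target` (stmt-SmoothPoincare4-7823), line kaehler-jacket,
# stub `helper_slowStep`

A **log-slow smooth monotone step**.  For every `t₁ > 0` and every `η > 0` there are a threshold
`t₀ ∈ (0, t₁)` and a `C^∞` function `χ : ℝ → ℝ` with `χ = 0` on `(-∞, t₀]`, `χ = 1` on `[t₁, ∞)`,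
`0 ≤ χ ≤ 1`, `χ' ≥ 0`, and the scale-invariant derivative bound `|t · χ'(t)| ≤ η` for *all* `t`.
This is the cut-off with which one interpolates between a collar map and the identity near a
sphere (`(1 - r) a'(r)` small) in collar / isotopy-extension arguments; it exists because
`∫ dt / t` diverges at `0`, so `t₀` may (and must) be taken exponentially small in `1/η`.

Construction.  Let `h` be a profile transition at `s = 1/2`, scale `ε = 1/2`
(`Literature.Geometry.GeometricMeasureTheory.IsProfileTransition`, built from
`Real.smoothTransition`): `h` is smooth and monotone, `h = 0` on `(-∞, 0]`, `h = 1` on `[1, ∞)`,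
and `0 ≤ h' ≤ B`.  Choose `L > 0` with `B / L ≤ η` (namely `L = max B 1 / η`), put
`t₀ = t₁ · e^{-L}` (so `log t₁ - log t₀ = L`) and
`χ t = h ((log t - log t₀) / L)` for `t > t₀ / 2`, `χ t = 0` for `t ≤ t₀ / 2`.
On the open set `(-∞, t₀)` the function `χ` vanishes identically (for `t₀/2 < t < t₀` the
argument of `h` is `≤ 0`), on the open set `(t₀/2, ∞)` it is the smooth branch; the two open sets
cover `ℝ`, which gives smoothness and the derivative: `χ' = 0` left of `t₀`, and
`t · χ'(t) = h'((log t - log t₀)/L) / L ∈ [0, B / L] ⊆ [0, η]` right of `t₀ / 2`.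

References: M. W. Hirsch, *Differential Topology*, GTM 33 (1976), Ch. 4 §5–6 and Ch. 8 §1
(collars, isotopy extension); J. Milnor, *Lectures on the h-cobordism theorem* (1965), §1.
Everything here is elementary real analysis on top of Mathlib (`Real.log`, `Real.exp`,
`Real.smoothTransition` through `IsProfileTransition`); no named facts are used.
-/

noncomputable section

-- the prescribed namespace `Summit.<P>.<Sub>.…` duplicates `SmoothPoincare4` (P = Sub)
set_option linter.dupNamespace false

open scoped Manifold ContDiff Topology
open Set Function
open Literature.Geometry.Kaehler (MForm IsSmoothForm IsClosedForm mextDeriv)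
open Literature.Geometry.Symplectic (punctured InPuncturedChartBall stdSymplecticForm inversion
  invertedStdForm IsSymplecticStandardNearPoint AgreesWithInvertedChartNear)
open Literature.Topology.FourManifolds (HomotopySphere)
open Literature.Geometry.GeometricMeasureTheory (IsProfileTransition exists_isProfileTransition)

namespace Summit.SmoothPoincare4.SmoothPoincare4.Theorems.Target.KaehlerJacket

/-! ### The smooth branch `t ↦ h ((log t - log t₀) / L)` on `(0, ∞)` -/

section LogStep

variable {h : ℝ → ℝ} {t₀ L : ℝ}

/-- The smooth branch `t ↦ h ((log t - log t₀) / L)` of the log-slow step has derivative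
`h'((log t - log t₀) / L) · (t⁻¹ / L)` at every `t > 0` (chain rule with `log' = t⁻¹`).
[folklore] -/
theorem hasDerivAt_logBranch (hh : IsProfileTransition h (1 / 2) (1 / 2)) {t : ℝ} (ht : 0 < t) :
    HasDerivAt (fun s => h ((Real.log s - Real.log t₀) / L))
      (deriv h ((Real.log t - Real.log t₀) / L) * (t⁻¹ / L)) t := by
  have h1 : HasDerivAt (fun s => (Real.log s - Real.log t₀) / L) (t⁻¹ / L) t :=
    ((Real.hasDerivAt_log ht.ne').sub_const _).div_const L
  exact (hh.hasDerivAt _).comp t h1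

/-- The smooth branch `t ↦ h ((log t - log t₀) / L)` of the log-slow step is `C^∞` at every
`t > 0` (`log` is smooth away from `0`). [folklore] -/
theorem contDiffAt_logBranch (hh : IsProfileTransition h (1 / 2) (1 / 2)) {t : ℝ} (ht : 0 < t) :
    ContDiffAt ℝ ∞ (fun s => h ((Real.log s - Real.log t₀) / L)) t := by
  have h1 : ContDiffAt ℝ ∞ (fun s => (Real.log s - Real.log t₀) / L) t :=
    ((Real.contDiffAt_log.mpr ht.ne').sub contDiffAt_const).div_const L
  exact hh.contDiff.contDiffAt.comp t h1

/-! ### The log-slow step `χ t = if t ≤ t₀/2 then 0 else h ((log t - log t₀) / L)` -/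

/-- The log-slow step vanishes on `(-∞, t₀]`: below `t₀ / 2` by definition, and on `(t₀/2, t₀]`
because there `log t ≤ log t₀`, so the argument of `h` is `≤ 0` and `h = 0` on `(-∞, 0]`.
[folklore] -/
theorem logStep_eq_zero_of_le (hh : IsProfileTransition h (1 / 2) (1 / 2)) (ht₀ : 0 < t₀)
    (hL : 0 < L) {χ : ℝ → ℝ}
    (hχ : ∀ t, χ t = if t ≤ t₀ / 2 then 0 else h ((Real.log t - Real.log t₀) / L))
    {t : ℝ} (ht : t ≤ t₀) : χ t = 0 := by
  rw [hχ t]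
  split_ifs with h2
  · rfl
  · rw [not_le] at h2
    apply hh.eq_zero_of_le
    have hlog : Real.log t ≤ Real.log t₀ := Real.log_le_log (by linarith) ht
    have : (Real.log t - Real.log t₀) / L ≤ 0 :=
      div_nonpos_of_nonpos_of_nonneg (by linarith) hL.le
    linarith

/-- Left of `t₀` the log-slow step agrees with the constant `0` near every point. [folklore] -/
theorem logStep_eventuallyEq_zero (hh : IsProfileTransition h (1 / 2) (1 / 2)) (ht₀ : 0 < t₀)
    (hL : 0 < L) {χ : ℝ → ℝ}
    (hχ : ∀ t, χ t = if t ≤ t₀ / 2 then 0 else h ((Real.log t - Real.log t₀) / L))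
    {t : ℝ} (ht : t < t₀) : χ =ᶠ[𝓝 t] fun _ => 0 := by
  filter_upwards [Iio_mem_nhds ht] with s hs
  exact logStep_eq_zero_of_le hh ht₀ hL hχ (le_of_lt hs)

/-- Right of `t₀ / 2` the log-slow step agrees with the smooth branch near every point.
[folklore] -/
theorem logStep_eventuallyEq_branch {χ : ℝ → ℝ}
    (hχ : ∀ t, χ t = if t ≤ t₀ / 2 then 0 else h ((Real.log t - Real.log t₀) / L))
    {t : ℝ} (ht : t₀ / 2 < t) :
    χ =ᶠ[𝓝 t] fun s => h ((Real.log s - Real.log t₀) / L) := by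
  filter_upwards [Ioi_mem_nhds ht] with s hs
  rw [hχ s, if_neg (not_le.mpr hs)]

/-- The log-slow step is `C^∞`: the open sets `(-∞, t₀)` (where it is `0`) and `(t₀/2, ∞)`
(where it is the smooth branch) cover `ℝ`. [folklore] -/
theorem contDiff_logStep (hh : IsProfileTransition h (1 / 2) (1 / 2)) (ht₀ : 0 < t₀)
    (hL : 0 < L) {χ : ℝ → ℝ}
    (hχ : ∀ t, χ t = if t ≤ t₀ / 2 then 0 else h ((Real.log t - Real.log t₀) / L)) :
    ContDiff ℝ ∞ χ := by
  refine contDiff_iff_contDiffAt.mpr fun t => ?_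
  rcases lt_or_ge t t₀ with ht | ht
  · exact (contDiffAt_const (c := (0 : ℝ))).congr_of_eventuallyEq
      (logStep_eventuallyEq_zero hh ht₀ hL hχ ht)
  · have ht' : t₀ / 2 < t := by linarith
    exact (contDiffAt_logBranch hh (by linarith)).congr_of_eventuallyEq
      (logStep_eventuallyEq_branch hχ ht')

/-- Left of `t₀` the derivative of the log-slow step vanishes (it is locally constant there).
[folklore] -/
theorem deriv_logStep_of_lt (hh : IsProfileTransition h (1 / 2) (1 / 2)) (ht₀ : 0 < t₀)
    (hL : 0 < L) {χ : ℝ → ℝ}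
    (hχ : ∀ t, χ t = if t ≤ t₀ / 2 then 0 else h ((Real.log t - Real.log t₀) / L))
    {t : ℝ} (ht : t < t₀) : deriv χ t = 0 := by
  rw [(logStep_eventuallyEq_zero hh ht₀ hL hχ ht).deriv_eq]
  exact deriv_const t 0

/-- Right of `t₀ / 2` the derivative of the log-slow step is that of the smooth branch,
`χ'(t) = h'((log t - log t₀) / L) · (t⁻¹ / L)`. [folklore] -/
theorem deriv_logStep_of_gt (hh : IsProfileTransition h (1 / 2) (1 / 2)) (ht₀ : 0 < t₀)
    {χ : ℝ → ℝ}
    (hχ : ∀ t, χ t = if t ≤ t₀ / 2 then 0 else h ((Real.log t - Real.log t₀) / L))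
    {t : ℝ} (ht : t₀ / 2 < t) :
    deriv χ t = deriv h ((Real.log t - Real.log t₀) / L) * (t⁻¹ / L) := by
  have ht0 : 0 < t := by linarith
  exact ((hasDerivAt_logBranch hh ht0).congr_of_eventuallyEq
    (logStep_eventuallyEq_branch hχ ht)).deriv

end LogStep

/-- **Helper A (log-slow monotone step).** For every `t₁ > 0` and `η > 0` there are `t₀ ∈ (0, t₁)`
and a `C^∞` function `χ : ℝ → ℝ` with `χ = 0` on `(-∞, t₀]`, `χ = 1` on `[t₁, ∞)`, `0 ≤ χ ≤ 1`,
`χ' ≥ 0` and `|t · χ'(t)| ≤ η` for all `t`.  Construction: `χ t = h ((log t - log t₀) / L)` for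
`t > t₀ / 2` and `0` below, with `h` a smooth monotone profile (`0` on `(-∞, 0]`, `1` on `[1, ∞)`,
`0 ≤ h' ≤ B`), `L = max B 1 / η` and `t₀ = t₁ e^{-L}`; then `t χ'(t) = h'(…) / L ≤ B / L ≤ η`.
[folklore] -/
theorem helper_slowStep :
    ∀ (t₁ η : ℝ), 0 < t₁ → 0 < η →
      ∃ (t₀ : ℝ) (χ : ℝ → ℝ), 0 < t₀ ∧ t₀ < t₁ ∧ ContDiff ℝ ∞ χ ∧
        (∀ t, t ≤ t₀ → χ t = 0) ∧ (∀ t, t₁ ≤ t → χ t = 1) ∧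
        (∀ t, 0 ≤ χ t ∧ χ t ≤ 1) ∧ (∀ t, 0 ≤ deriv χ t) ∧ (∀ t, |t * deriv χ t| ≤ η) := by
  intro t₁ η ht₁ hη
  -- a smooth monotone profile `h`: `0` on `(-∞, 0]`, `1` on `[1, ∞)`, with `h' ≤ B`
  obtain ⟨h, hh⟩ := exists_isProfileTransition (1 / 2 : ℝ) (by norm_num : (0 : ℝ) < 1 / 2)
  obtain ⟨B, -, hB⟩ := hh.exists_deriv_le
  -- the rate `L > 0` with `h' / L ≤ η`
  obtain ⟨L, hL, hBL⟩ : ∃ L : ℝ, 0 < L ∧ ∀ x, deriv h x / L ≤ η := by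
    have hB' : 0 < max B 1 := lt_of_lt_of_le one_pos (le_max_right _ _)
    refine ⟨max B 1 / η, div_pos hB' hη, fun x => ?_⟩
    rw [div_le_iff₀ (div_pos hB' hη)]
    calc deriv h x ≤ max B 1 := (hB x).trans (le_max_left _ _)
      _ = η * (max B 1 / η) := by field_simp
  -- the threshold `t₀ = t₁ e^{-L}`, so that `log t₁ - log t₀ = L`
  set t₀ : ℝ := t₁ * Real.exp (-L) with ht₀def
  have ht₀ : 0 < t₀ := mul_pos ht₁ (Real.exp_pos _)
  have ht₀₁ : t₀ < t₁ := by
    have hexp : Real.exp (-L) < 1 := Real.exp_lt_one_iff.mpr (by linarith)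
    have := mul_lt_mul_of_pos_left hexp ht₁
    simpa [ht₀def] using this
  have hlog₀ : Real.log t₀ = Real.log t₁ - L := by
    rw [ht₀def, Real.log_mul ht₁.ne' (Real.exp_pos _).ne', Real.log_exp]
    ring
  -- the step
  set χ : ℝ → ℝ := fun t => if t ≤ t₀ / 2 then 0 else h ((Real.log t - Real.log t₀) / L)
    with hχdef
  have hχ : ∀ t, χ t = if t ≤ t₀ / 2 then 0 else h ((Real.log t - Real.log t₀) / L) :=
    fun _ => rfl
  refine ⟨t₀, χ, ht₀, ht₀₁, contDiff_logStep hh ht₀ hL hχ,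
    fun t ht => logStep_eq_zero_of_le hh ht₀ hL hχ ht, ?_, ?_, ?_, ?_⟩
  · -- `χ = 1` on `[t₁, ∞)`: the argument of `h` is `≥ (log t₁ - log t₀) / L = 1`
    intro t ht
    have ht' : t₀ / 2 < t := by linarith
    rw [hχ t, if_neg (not_le.mpr ht')]
    apply hh.eq_one_of_le
    have hlt : Real.log t₁ ≤ Real.log t := Real.log_le_log ht₁ ht
    have h1 : 1 ≤ (Real.log t - Real.log t₀) / L := by
      rw [le_div_iff₀ hL, hlog₀]
      linarith
    linarith
  · -- values in `[0, 1]`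
    intro t
    rw [hχ t]
    split_ifs
    · exact ⟨le_rfl, zero_le_one⟩
    · exact ⟨hh.nonneg _, hh.le_one _⟩
  · -- `χ' ≥ 0`
    intro t
    rcases lt_or_ge t t₀ with ht | ht
    · rw [deriv_logStep_of_lt hh ht₀ hL hχ ht]
    · have ht' : t₀ / 2 < t := by linarith
      rw [deriv_logStep_of_gt hh ht₀ hχ ht']
      exact mul_nonneg (hh.deriv_nonneg _) (div_nonneg (inv_nonneg.mpr (by linarith)) hL.le)
  · -- `|t χ'(t)| ≤ η`
    intro t
    rcases lt_or_ge t t₀ with ht | ht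
    · rw [deriv_logStep_of_lt hh ht₀ hL hχ ht, mul_zero, abs_zero]
      exact hη.le
    · have ht' : t₀ / 2 < t := by linarith
      have ht0 : 0 < t := by linarith
      rw [deriv_logStep_of_gt hh ht₀ hχ ht']
      have hcalc : t * (deriv h ((Real.log t - Real.log t₀) / L) * (t⁻¹ / L)) =
          deriv h ((Real.log t - Real.log t₀) / L) / L := by
        field_simp
      rw [hcalc, abs_of_nonneg (div_nonneg (hh.deriv_nonneg _) hL.le)]
      exact hBL _

end Summit.SmoothPoincare4.SmoothPoincare4.Theorems.Target.KaehlerJacket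

end
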